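import Mathlib
import Summits.Ventures.PercRepro.TriangleCapTableStatement

/-!
# PercRepro — THE CLOSED FORM ON THE SPARSE SIDE: the table `table_km` in the variables of the closed form
(p3, gen 34; part 37)

P3-TRIANGLE-CAP.md §10av conjectures the `K₄⁻`-free cherry maximum at `(k, m)` to be
`max (STAR(k, m)) ((m(k−2) − r(k − r − 1))/2)` with `r = δ(m) − m`, `δ(m)` the least `a(k−a) ≥ m`.  On the sparse
side `m ≤ 2k − 4` the table is a theorem (`table_km`), and this module checks that it IS the closed form:

* `closed_form_star_rows` — for `m ≤ k − 1`: `δ(m) = k − 1`, `r = k − 1 − m`, and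
  `2·C(m, 2) + r·(k − r − 1) = m (k − 2)`: the star value `C(m, 2)` is the `r`-term;
* `closed_form_bipPend` — for `k ≤ m ≤ 2k − 4`: `δ(m) = 2(k − 2)`, `r = 2k − 4 − m`, and with `t = m + 1 − k`
  `2·(C(k−2, 2) + C(t+1, 2) + t + 1) + r·(k − r − 1) = m (k − 2)`: the bipPend value is the `r`-term;
* **`table_km_closed_form`** — for `k ≤ m ≤ 2k − 4` the maximum of `2·Σ_v C(d(v), 2)` over `K₄⁻`-free graphs with
  `m` edges on `k` vertices IS `max (2 C(k−1, 2) + 4t) (m(k−2) − r(k−r−1))`, `t = m + 1 − k`, `r = 2k − 4 − m`.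

Axioms: standard.
-/

namespace PercRepro

namespace TriangleCap

namespace C047

open Finset

/-- `2·C(n, 2) = n (n − 1)` in the form `2·C(n, 2) + n = n·n`. -/
theorem two_mul_choose_two_add' (n : ℕ) : 2 * n.choose 2 + n = n * n := two_mul_choose_two_add n

/-- On the star rows the closed form's `r`-term is the star value: `2·C(m, 2) + (k − 1 − m)·m = m (k − 2)`. -/
theorem closed_form_star_rows (k m : ℕ) (hm : m + 1 ≤ k) :
    2 * m.choose 2 + (k - 1 - m) * (k - (k - 1 - m) - 1) = m * (k - 2) := by
  obtain ⟨r, hr⟩ : ∃ r, k = m + 1 + r := ⟨k - 1 - m, by omega⟩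
  subst hr
  have e1 : m + 1 + r - 1 - m = r := by omega
  have e2 : m + 1 + r - r - 1 = m := by omega
  have e3 : m + 1 + r - 2 = m + r - 1 := by omega
  rw [e1, e2, e3]
  have h := two_mul_choose_two_add m
  cases m with
  | zero => simp
  | succ m =>
    have e4 : m + 1 + r - 1 = m + r := by omega
    rw [e4]
    nlinarith [h]

/-- Below the threshold the closed form's `r`-term is the bipPend value:
`2·(C(k−2, 2) + C(t+1, 2) + t + 1) + r (k − r − 1) = m (k − 2)` for `m = k − 1 + t`, `r = 2k − 4 − m`. -/
theorem closed_form_bipPend (k t : ℕ) (ht : t + 3 ≤ k) :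
    2 * ((k - 2).choose 2 + (t + 1).choose 2 + t + 1) +
      (2 * k - 4 - (k - 1 + t)) * (k - (2 * k - 4 - (k - 1 + t)) - 1) = (k - 1 + t) * (k - 2) := by
  obtain ⟨r, hr⟩ : ∃ r, k = t + 3 + r := ⟨k - t - 3, by omega⟩
  subst hr
  have e1 : 2 * (t + 3 + r) - 4 - (t + 3 + r - 1 + t) = r := by omega
  have e2 : t + 3 + r - r - 1 = t + 2 := by omega
  have e3 : t + 3 + r - 2 = t + r + 1 := by omega
  have e4 : t + 3 + r - 1 + t = 2 * t + r + 2 := by omega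
  rw [e1, e2, e3, e4]
  have h1 := two_mul_choose_two_succ (t + r)
  have h2 := two_mul_choose_two_succ t
  have e5 : 2 * ((t + r + 1).choose 2 + (t + 1).choose 2 + t + 1) =
      2 * (t + r + 1).choose 2 + 2 * (t + 1).choose 2 + 2 * t + 2 := by ring
  rw [e5, h1, h2]
  ring

/-- **THE CLOSED FORM ON THE SPARSE SIDE:** for `k ≤ m ≤ 2k − 4`, with `t = m + 1 − k` and `r = 2k − 4 − m`, the
maximum of `2·Σ_v C(d(v), 2)` over `K₄⁻`-free graphs with `m` edges on `k` vertices is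
`max (2·C(k−1, 2) + 4t) (m(k−2) − r(k − r − 1))`. -/
theorem table_km_closed_form (k m : ℕ) (hk : k ≤ m) (hm : m + 4 ≤ 2 * k) :
    (∀ (D : SimpleGraph (Fin k)) [DecidableRel D.Adj], K4mFree D → D.edgeFinset.card = m →
        2 * cherries D ≤ max (2 * (k - 1).choose 2 + 4 * (m + 1 - k))
          (m * (k - 2) - (2 * k - 4 - m) * (k - (2 * k - 4 - m) - 1))) ∧
      ∃ (D : SimpleGraph (Fin k)) (_ : DecidableRel D.Adj),
        K4mFree D ∧ D.edgeFinset.card = m ∧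
          2 * cherries D = max (2 * (k - 1).choose 2 + 4 * (m + 1 - k))
            (m * (k - 2) - (2 * k - 4 - m) * (k - (2 * k - 4 - m) - 1)) := by
  obtain ⟨h1, D, inst, hK, hD, hc⟩ := table_km k m hm
  have hif : ¬ (m + 1 ≤ k) := by omega
  simp only [if_neg hif] at h1 hc
  obtain ⟨t, ht⟩ : ∃ t, m = k - 1 + t := ⟨m + 1 - k, by omega⟩
  have e1 : m + 1 - k = t := by omega
  have e2 : m + 2 - k = t + 1 := by omega
  have hb := closed_form_bipPend k t (by omega)
  rw [← ht] at hb
  -- the closed form's second term is the bipPend value, doubled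
  have key : m * (k - 2) - (2 * k - 4 - m) * (k - (2 * k - 4 - m) - 1) =
      2 * ((k - 2).choose 2 + (t + 1).choose 2 + t + 1) := by omega
  have key2 : ∀ c : ℕ, 2 * c ≤ max (2 * (k - 1).choose 2 + 4 * t)
      (2 * ((k - 2).choose 2 + (t + 1).choose 2 + t + 1)) ↔
      c ≤ max ((k - 1).choose 2 + 2 * t) ((k - 2).choose 2 + (t + 1).choose 2 + t + 1) := by
    intro c
    constructor
    · intro h
      rcases le_max_iff.mp h with h | h
      · exact le_max_of_le_left (by omega)
      · exact le_max_of_le_right (by omega)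
    · intro h
      rcases le_max_iff.mp h with h | h
      · exact le_max_of_le_left (by omega)
      · exact le_max_of_le_right (by omega)
  rw [e1, key]
  refine ⟨fun D' _ hK' hD' => ?_, D, inst, hK, hD, ?_⟩
  · have := h1 D' hK' hD'
    rw [e1, e2] at this
    exact (key2 _).mpr this
  · rw [e1, e2] at hc
    rcases le_total ((k - 1).choose 2 + 2 * t) ((k - 2).choose 2 + (t + 1).choose 2 + (t + 1)) with h | h
    · rw [max_eq_right h] at hc
      rw [max_eq_right (by omega : 2 * (k - 1).choose 2 + 4 * t ≤
        2 * ((k - 2).choose 2 + (t + 1).choose 2 + t + 1))]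
      omega
    · rw [max_eq_left h] at hc
      rw [max_eq_left (by omega : 2 * ((k - 2).choose 2 + (t + 1).choose 2 + t + 1) ≤
        2 * (k - 1).choose 2 + 4 * t)]
      omega

end C047

end TriangleCap

end PercRepro
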